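import Summits.ResolutionOfSingularities.ResolutionOfSingularities.Theorems.FrobeniusClosingSteerSwitchingSetup
import Summits.ResolutionOfSingularities.ResolutionOfSingularities.Theorems.ValuativeLuAlphaPTorsorSequenceModel
import Summits.ResolutionOfSingularities.ResolutionOfSingularities.Theorems.ValuativeLuAlphaPTorsorBirationalExit
import Summits.ResolutionOfSingularities.ResolutionOfSingularities.Theorems.ValuativeLuAlphaPTorsorMonogenicExit
import Literature.AlgebraicGeometry.Resolution.RsopMonomialIdeals
import Literature.AlgebraicGeometry.Resolution.RootAdjunctionRegular
import Literature.AlgebraicGeometry.Resolution.RankOneReductionProofs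
import HarnessLib

/-!
# Crux `Steer` (stmt-ResolutionOfSingularities-16345), line `switching_dichotomy` r8: the ORDER-ONE EXIT
# (stub `stub_core4OrderOneExit`, Theses-free body)

OURS (campaign `res-hironaka`, rung L, slot W4.1, chain W4.1; replaces the role of no printed item; NOT
a statement of the manuscript under review). This file PROVES the body of the registered r8 stub
`stub_core4OrderOneExit` (plan-of-record `L/w41/line-switching_dichotomy-r8.lean`, `Sig.stub_core4OrderOneExit`;
CHAIN w41 v3.1 row stub-3) with the r8 vocabulary (`IsTorsorRunUpTo`, `IsStrictStep`, `IsExcParam`,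
`OrderOneAt`, `Concl`) UNFOLDED verbatim, so that the by-name leaf for the registered skeleton is a
definitional `exact` (`orderOneExit`):

for a datum `t ^ p ∈ A₀ ⊆ O` (`A₀` finitely generated, regular at the centre, `Frac (A₀[t]) = K`), the
quadratic sequence `R` of the base along `O`, and a torsor run `s` of `t` along `R` up to stage `N`
(`s 0 = t`, `s i = x_i · s (i+1) + g_i` with `x_i, g_i ∈ R i`) which is in ORDER-ONE FORM at stage `N`
— `(s N) ^ p − g ^ p = z` with `g ∈ R N` and `z` a one-element part of a regular system of parameters of
`R N` — SOME finitely generated `A ⊇ A₀` with `t ∈ A ⊆ O`, `Frac A = K` is regular at the centre of `O`.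

Proof (the packaging of the sibling crux's `stub_monogenicExit`, `Theorems/ValuativeLuAlphaPTorsorMonogenicExit.lean`,
with Stacks 07PG replaced by ROOT ADJUNCTION): `R N` is the local ring at the centre of a finitely
generated model `A₀ ≤ A₁ ⊆ O`, realised inside `K` (`exists_model_of_sequence_member`:
`R N = locAtCentre A₁ O`). Put `w := s N − g`, so `w ^ p = z` (characteristic `p`) and `w ∈ O`. The ring
`B := (R N)[Z]/(Z ^ p − z)` is a REGULAR LOCAL ring (`AdjoinRoot.isRegularLocalRing_X_pow_sub_C`: adjoining
a `p`-th root of a regular parameter, tree `RootAdjunctionRegular.lean`), hence a domain, so the lift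
`ψ : B → K`, `Z ↦ w`, is injective (its kernel lies over `0` in the integral extension `R N ⊆ B`) and
`T := ψ(B) = (R N)[w] ⊆ O` is a regular ring. The model is `A := A₁[t][w]`: it contains `t`
(`t = X · s N + G` with `X, G ∈ R N` by the run, so `t = X w + (X g + G) ∈ T`), and
`A ⊆ T ⊆ A_𝔮` inside `K` (elements of `R N` are fractions `a / c`, `a, c ∈ A₁`, `ν(c) = 0`), so `A`
and `T` have the same local ring at the centre (Novacoski–Spivakovsky 2014, Lemma 2.5 (1):
`centreLocalization_le`, `isRegularLocalRing_of_centreLocalization_eq`), and the latter is a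
localisation of the regular ring `T ≅ B`. [cite: HeinzerEtAl2015, Prop. 4.4]
[cite: Matsumura1987, Thm. 14.2] [folklore]
-/

noncomputable section

-- `Summit.<S>.<S>.…` duplicates the summit name by design (single-problem summit).
set_option linter.dupNamespace false

open Polynomial IsLocalRing

namespace Summit.ResolutionOfSingularities.ResolutionOfSingularities.Theorems.SwitchingDichotomy

open Literature.AlgebraicGeometry.Resolution
open Summit.ResolutionOfSingularities.ResolutionOfSingularities.Theorems.PfaffLine
  (exists_model_of_sequence_member adjoinRoot_mem_subring mem_valuationSubring_of_pow_mem
    adjoin_insert_toSubring_le le_adjoin_insert mem_adjoin_insert fg_adjoin_insert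
    isRegularLocalRing_centre_of_ringEquiv)

namespace OrderOneExit

/-! ## Small glue (the one-liners `mem_valuationSubring_of_pow_mem`, `adjoin_insert_toSubring_le`,
`le_adjoin_insert`, `mem_adjoin_insert`, `fg_adjoin_insert`, `adjoinRoot_mem_subring`,
`isRegularLocalRing_centre_of_ringEquiv` are the landed ones of the sibling crux's exit files) -/

section Glue

variable {k K : Type} [Field k] [Field K] [Algebra k K]

/-- **The run bookkeeping**: along a torsor run up to stage `N`, `t = X · s N + G` with `X, G ∈ R N`
(`s i = x_i s (i+1) + g_i` and the sequence `R` is increasing). [folklore] -/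
theorem exists_eq_mul_add_of_run (O : ValuationSubring K) {R : ℕ → Subring K} (hmono : Monotone R)
    {p : ℕ} {t : K} {s : ℕ → K} {N : ℕ}
    (hrun : s 0 = t ∧ (∀ i ≤ N, s i ^ p ∈ R i) ∧
      ∀ i < N, ∃ x g : K, (x ∈ R i ∧ x ≠ 0 ∧ O.valuation x < 1 ∧
        ∀ y ∈ R i, O.valuation y < 1 → O.valuation y ≤ O.valuation x) ∧
        g ∈ R i ∧ s i = x * s (i + 1) + g) :
    ∃ X ∈ R N, ∃ G ∈ R N, t = X * s N + G := by
  obtain ⟨hs0, -, hss⟩ := hrun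
  have key : ∀ i ≤ N, ∃ X ∈ R i, ∃ G ∈ R i, t = X * s i + G := by
    intro i
    induction i with
    | zero => exact fun _ => ⟨1, (R 0).one_mem, 0, (R 0).zero_mem, by rw [hs0, one_mul, add_zero]⟩
    | succ i ih =>
      intro hi
      obtain ⟨X, hX, G, hG, ht⟩ := ih (Nat.le_of_succ_le hi)
      obtain ⟨x, g, ⟨hx, -, -, -⟩, hg, hsi⟩ := hss i (Nat.lt_of_succ_le hi)
      have hle : R i ≤ R (i + 1) := hmono (Nat.le_succ i)
      refine ⟨X * x, hle ((R i).mul_mem hX hx), X * g + G, hle ((R i).add_mem ((R i).mul_mem hX hg) hG), ?_⟩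
      rw [ht, hsi]; ring
  exact key N le_rfl

end Glue

/-! ## The root adjunction ring `(R N)[Z]/(Z ^ p − z)` over a member of the sequence -/

section Root

variable {K : Type} [Field K]

/-- For a one-element part `z` of a regular system of parameters of a local subring `S` of `K` and
`p ≥ 1`, `S[Z]/(Z ^ p − z)` is a regular local ring, and every lift `S[Z]/(Z ^ p − z) → K` extending the
inclusion is injective. [cite: Matsumura1987, Thm. 14.2] [folklore] -/
theorem root_regular_and_lift_injective (S : Subring K) [IsLocalRing S] (z : Fin 1 → S)
    (hz : IsRsopPart z) {p : ℕ} (hp : 0 < p) (w : K)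
    (hev : (X ^ p - C (z 0) : S[X]).eval₂ S.subtype w = 0) :
    ∃ _ : IsLocalRing (AdjoinRoot (X ^ p - C (z 0) : S[X])),
      IsRegularLocalRing (AdjoinRoot (X ^ p - C (z 0) : S[X])) ∧
      Function.Injective (AdjoinRoot.lift S.subtype w hev) := by
  obtain ⟨hreg, e, y, hdim, hspan⟩ := hz
  haveI := hreg
  have hrz : Set.range z = {z 0} := by
    ext a
    constructor
    · rintro ⟨i, rfl⟩; rw [Subsingleton.elim i 0]; rfl
    · rintro rfl; exact ⟨0, rfl⟩
  have hgen : Ideal.span (insert (z 0) (Set.range y)) = maximalIdeal S := by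
    rw [← hspan, hrz, Set.singleton_union]
  have hdim' : ringKrullDim S = e + 1 := by
    rw [hdim, Nat.cast_add, Nat.cast_one, add_comm]
  obtain ⟨hloc, hBreg, -, -, -, -⟩ := AdjoinRoot.isRegularLocalRing_X_pow_sub_C y (z 0) hgen hdim' hp
  refine ⟨hloc, hBreg, ?_⟩
  haveI := hloc
  haveI := hBreg
  set f : S[X] := X ^ p - C (z 0) with hf
  haveI : IsDomain (AdjoinRoot f) := isDomain_of_isRegularLocalRing _
  haveI : Module.Finite S (AdjoinRoot f) := (monic_X_pow_sub_C (z 0) hp.ne').finite_adjoinRoot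
  haveI : Algebra.IsIntegral S (AdjoinRoot f) := inferInstance
  rw [RingHom.injective_iff_ker_eq_bot]
  apply Ideal.eq_bot_of_comap_eq_bot (R := S)
  rw [AdjoinRoot.algebraMap_eq, RingHom.comap_ker, AdjoinRoot.lift_comp_of,
    ← RingHom.injective_iff_ker_eq_bot]
  exact S.subtype_injective

end Root

end OrderOneExit

open OrderOneExit

/-! ## The order-one exit -/

/-- **`stub_core4OrderOneExit`, body (line `switching_dichotomy` r8; the registered `Sig.stub_core4OrderOneExit`
with `IsTorsorRunUpTo` / `IsStrictStep` / `IsExcParam` / `OrderOneAt` / `Concl` unfolded verbatim).** If a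
torsor run of the datum `t` along the quadratic sequence `R` of the base reaches a stage `N` in order-one
form — `(s N) ^ p − g ^ p = z` with `g ∈ R N` and `z` a one-element part of a regular system of parameters
of `R N` — then some finitely generated `A ⊇ A₀` with `t ∈ A ⊆ O` and `Frac A = K` is regular at the
centre of `O`: `A = A₁[t][w]` with `w = s N − g`, `w ^ p = z`, `A₁` a model of `R N`, compared inside
`K` with the regular ring `(R N)[w] ≅ (R N)[Z]/(Z ^ p − z)`. The hypothesis
`IsRegularLocalRing (A₀ at the centre)` of the registered signature is not used (regularity of `R N` is
part of `IsRsopPart`). [cite: HeinzerEtAl2015, Prop. 4.4] [cite: Matsumura1987, Thm. 14.2] [folklore] -/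
theorem orderOneExit :
    ∀ p : ℕ, p.Prime → ∀ (k K : Type) [Field k] [CharP k p] [Field K] [Algebra k K]
      (O : ValuationSubring K) (A₀ : Subalgebra k K) (h₀ : A₀.toSubring ≤ O.toSubring) (t : K),
      A₀.FG → t ^ p ∈ A₀ → IsFractionRing (Algebra.adjoin k (insert t (A₀ : Set K))) K →
      IsRegularLocalRing (Localization.AtPrime
        (Ideal.comap (Subring.inclusion h₀) (IsLocalRing.maximalIdeal O))) →
      ∀ R : ℕ → Subring K, R 0 = locAtCentre A₀.toSubring O →
        (∀ i, IsQuadraticTransformAlong O (R i) (R (i + 1))) →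
        ∀ (s : ℕ → K) (N : ℕ),
          (s 0 = t ∧ (∀ i ≤ N, s i ^ p ∈ R i) ∧
            ∀ i < N, ∃ x g : K, (x ∈ R i ∧ x ≠ 0 ∧ O.valuation x < 1 ∧
              ∀ y ∈ R i, O.valuation y < 1 → O.valuation y ≤ O.valuation x) ∧
              g ∈ R i ∧ s i = x * s (i + 1) + g) →
          (∃ g ∈ R N, ∃ (_ : IsLocalRing (R N)) (z : Fin 1 → R N), IsRsopPart z ∧
            ((z 0 : R N) : K) = s N ^ p - g ^ p) →
          ∃ (A : Subalgebra k K) (h : A.toSubring ≤ O.toSubring), A₀ ≤ A ∧ t ∈ A ∧ A.FG ∧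
            IsFractionRing A K ∧ IsRegularLocalRing (Localization.AtPrime
              (Ideal.comap (Subring.inclusion h) (IsLocalRing.maximalIdeal O))) := by
  intro p hp k K _ _ _ _ O A₀ h₀ t hfg htp hfr _ R hR0 hstep s N hrun hone
  classical
  haveI := Fact.mk hp
  haveI : CharP K p := charP_of_injective_algebraMap (algebraMap k K).injective p
  obtain ⟨g₁, hg₁, hloc, z, hz, hz0⟩ := hone
  haveI := hloc
  -- ### (1) `R N` is the local ring at the centre of a finitely generated model `A₀ ≤ A₁ ⊆ O`
  have hO : O.comap (RingHom.id K) = O := by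
    ext x
    rfl
  have hS : A₀.toSubring.comap (RingHom.id K) = A₀.toSubring := by
    ext x
    rfl
  obtain ⟨A₁, h₁, hle, hfg₁, -, hRN', -⟩ := exists_model_of_sequence_member k K K (RingHom.id K)
    O A₀ h₀ hfg (fun x _ => RingHom.mem_range.mpr ⟨x, rfl⟩) R (by rw [hO, hS]; exact hR0)
    (by rw [hO]; exact hstep) N
  have hRN : locAtCentre A₁.toSubring O = R N := by
    rw [← hRN']
    ext x
    rfl
  have hRO : R N ≤ O.toSubring := hRN ▸ locAtCentre_le h₁
  have hA₁R : A₁.toSubring ≤ R N := hRN ▸ le_locAtCentre A₁.toSubring O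
  have hRfrac : ∀ r ∈ R N, ∃ a ∈ A₁, ∃ c ∈ A₁, O.valuation c = 1 ∧ r = a / c := fun r hr => by
    rw [← hRN] at hr
    exact mem_locAtCentre_iff.mp hr
  -- ### (2) the run: `t = X · s N + G`, and the order-one form: `w ^ p = z`
  obtain ⟨Xr, hXr, Gr, hGr, ht_run⟩ := exists_eq_mul_add_of_run O (sequence_monotone hstep) hrun
  set w : K := s N - g₁ with hw_def
  have hw : w ^ p = ((z 0 : R N) : K) := by rw [hz0, hw_def, sub_pow_char]
  have hwO : w ∈ O := mem_valuationSubring_of_pow_mem O hp.ne_zero (by rw [hw]; exact hRO (z 0).2)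
  have htO : t ∈ O := mem_valuationSubring_of_pow_mem O hp.ne_zero (h₀ htp)
  have ht_eq : t = Xr * w + (Xr * g₁ + Gr) := by rw [ht_run, hw_def]; ring
  -- ### (3) the model `A = A₁[t][w]`
  set At : Subalgebra k K := Algebra.adjoin k (insert t (A₁ : Set K))
  set A : Subalgebra k K := Algebra.adjoin k (insert w (At : Set K))
  have hAtO : At.toSubring ≤ O.toSubring := adjoin_insert_toSubring_le O.toSubring A₁ h₁ htO
  have hAO : A.toSubring ≤ O.toSubring := adjoin_insert_toSubring_le O.toSubring At hAtO hwO
  have hA₁A : A₁ ≤ A := (le_adjoin_insert A₁ t).trans (le_adjoin_insert At w)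
  have hA₀A : A₀ ≤ A := hle.trans hA₁A
  have htA : t ∈ A := le_adjoin_insert At w (mem_adjoin_insert A₁ t)
  have hwA : w ∈ A := mem_adjoin_insert At w
  haveI := hfr
  have hA₀tA : Algebra.adjoin k (insert t (A₀ : Set K)) ≤ A :=
    Algebra.adjoin_le (Set.insert_subset htA fun x hx => hA₀A hx)
  have hAfr : IsFractionRing A K :=
    isFractionRing_subalgebra_of_le (Algebra.adjoin k (insert t (A₀ : Set K))) A hA₀tA
  refine ⟨A, hAO, hA₀A, htA, fg_adjoin_insert (fg_adjoin_insert hfg₁ t) w, hAfr, ?_⟩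
  -- ### (4) the abstract ring `B = (R N)[Z]/(Z ^ p − z)` and its embedding `ψ : B → K`, `Z ↦ w`
  have hev : (X ^ p - C (z 0) : (R N)[X]).eval₂ (R N).subtype w = 0 := by
    rw [eval₂_sub, eval₂_X_pow, eval₂_C, hw]
    exact sub_self _
  obtain ⟨hBloc, hBreg, hψinj⟩ := root_regular_and_lift_injective (R N) z hz hp.pos w hev
  haveI := hBloc
  haveI := hBreg
  set ψ : AdjoinRoot (X ^ p - C (z 0) : (R N)[X]) →+* K := AdjoinRoot.lift (R N).subtype w hev
  have hψof : ∀ r : R N, ψ (AdjoinRoot.of _ r) = (r : K) := fun r => AdjoinRoot.lift_of hev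
  have hψroot : ψ (AdjoinRoot.root _) = w := AdjoinRoot.lift_root hev
  haveI : IsRegularRing (AdjoinRoot (X ^ p - C (z 0) : (R N)[X])) :=
    isRegularRing_iff.mpr fun q _ => isRegularLocalRing_localization_atPrime _ q
  -- its image `T = (R N)[w] ⊆ O`, a model containing `A`
  let T : Subalgebra k K :=
    { ψ.range with
      algebraMap_mem' := fun x =>
        ⟨AdjoinRoot.of _ ⟨algebraMap k K x, hA₁R (A₁.algebraMap_mem x)⟩, hψof _⟩ }
  have hmemT : ∀ {S' : Subring K}, R N ≤ S' → w ∈ S' → (T : Set K) ⊆ S' := by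
    intro S' hS' hwS'
    rintro _ ⟨x, rfl⟩
    refine adjoinRoot_mem_subring _ (S'.comap ψ) (fun r => ?_) ?_ x
    · rw [Subring.mem_comap, hψof]
      exact hS' r.2
    · rw [Subring.mem_comap, hψroot]
      exact hwS'
  have hTO : T.toSubring ≤ O.toSubring := fun x hx => hmemT (S' := O.toSubring) hRO hwO hx
  have hRT : ∀ r ∈ R N, r ∈ T := fun r hr => ⟨AdjoinRoot.of _ ⟨r, hr⟩, hψof _⟩
  have hA₁T : (A₁ : Set K) ⊆ T := fun a ha => hRT a (hA₁R ha)
  have hwT : w ∈ T := ⟨_, hψroot⟩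
  have htT : t ∈ T := by
    rw [ht_eq]
    exact T.add_mem (T.mul_mem (hRT _ hXr) hwT)
      (T.add_mem (T.mul_mem (hRT _ hXr) (hRT _ hg₁)) (hRT _ hGr))
  have hAtT : At ≤ T := Algebra.adjoin_le (Set.insert_subset htT hA₁T)
  have hAT : A ≤ T := Algebra.adjoin_le (Set.insert_subset hwT hAtT)
  haveI : IsFractionRing A.toSubring K := hAfr
  haveI : IsFractionRing T.toSubring K := isFractionRing_subalgebra_of_le A T hAT
  -- ### (5) `A ⊆ T ⊆ A_𝔮` inside `K`: the two models have the same local ring at the centre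
  have hTΛ : (T : Set K) ⊆ Localization.subalgebra.ofField K
      ((maximalIdeal O).comap (Subring.inclusion hAO)).primeCompl
      (Ideal.primeCompl_le_nonZeroDivisors _) := by
    refine hmemT (S' := (Localization.subalgebra.ofField K
      ((maximalIdeal O).comap (Subring.inclusion hAO)).primeCompl
      (Ideal.primeCompl_le_nonZeroDivisors _)).toSubring) (fun r hr => ?_)
      (le_centreLocalization O A hAO hwA)
    rw [Subalgebra.mem_toSubring, mem_centreLocalization_iff]
    obtain ⟨a, ha, c, hc, hc1, rfl⟩ := hRfrac r hr
    exact ⟨a, hA₁A ha, c, hA₁A hc, hc1, div_eq_mul_inv a c⟩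
  have heq : ((Localization.subalgebra.ofField K
      ((maximalIdeal O).comap (Subring.inclusion hAO)).primeCompl
      (Ideal.primeCompl_le_nonZeroDivisors _)) : Set K) =
      Localization.subalgebra.ofField K
      ((maximalIdeal O).comap (Subring.inclusion hTO)).primeCompl
      (Ideal.primeCompl_le_nonZeroDivisors _) :=
    le_antisymm (centreLocalization_le O A T hAO hTO
        ((show (A : Set K) ⊆ T from hAT).trans (le_centreLocalization O T hTO)))
      (centreLocalization_le O T A hTO hAO hTΛ)
  refine isRegularLocalRing_of_centreLocalization_eq O A T hAO hTO heq ?_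
  -- ### (6) `T ≅ B` is a regular ring, so its localisation at the centre is regular
  let ψ' : AdjoinRoot (X ^ p - C (z 0) : (R N)[X]) →+* T.toSubring :=
    ψ.codRestrict T.toSubring fun x => ⟨x, rfl⟩
  have hψ'bij : Function.Bijective ψ' :=
    ⟨fun x y hxy => hψinj (congrArg Subtype.val hxy), fun ⟨y, x, hx⟩ => ⟨x, Subtype.ext hx⟩⟩
  exact isRegularLocalRing_centre_of_ringEquiv O T hTO (RingEquiv.ofBijective ψ' hψ'bij)
    inferInstance

end Summit.ResolutionOfSingularities.ResolutionOfSingularities.Theorems.SwitchingDichotomy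

end
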